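/-
Copyright (c) 2026. All rights reserved.
Released under Apache 2.0 license as described in the file LICENSE.
-/
import Literature.NumberTheory.Automorphic.HurwitzOrderLattice
import Literature.NumberTheory.Automorphic.QuaternionRamificationParity
import Literature.NumberTheory.QuadraticForms.HilbertReciprocityRat
import Literature.NumberTheory.Automorphic.BrandtModuleDictionary
import HarnessLib

/-!
# `(−1,−1)_ℚ = ℍ[ℚ]` is ramified exactly at `2` and `∞`: `Ram_f ℍ[ℚ] = {2}` in the `IsSplitAt` language (the format of
# the Brandt setups `Brandt.XiSetup 1 2`), and `ℍ[ℚ]` is totally definite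

Second file of the quaternionic proof of Gauss's three-squares count (after `…HurwitzOrderLattice`, which made the Hurwitz
order `O = ℤ⟨ρ, i, j, k⟩` a maximal `ℤ`-order of Mathlib's `ℍ[ℚ]` in the Brandt–Eichler lattice framework of
`NumberTheory/Automorphic`). A Brandt setup `Brandt.XiSetup N⁺ N⁻` (the input of the tree's evaluated elliptic terms
`Brandt.XiSetup.sum_card_traceNormSet_div_eq_sum_hw_br`, Vignéras V §2 Prop. 2.4 with III.5.11–5.12) asks for: a totally
definite quaternion algebra (`IsTotallyDefinite`), `ramifiedPlaces ℚ D = {v | p_v ∣ N⁻}` with `N⁻` squarefree, and an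
Eichler order of level `N⁺`. This file supplies the two ramification clauses for `D = ℍ[ℚ]`, `N⁻ = 2`, from the tree's
general theorems, the only input specific to `(−1,−1)_ℚ` being the Hilbert symbols `(−1,−1)_p`:

* §1 `localSign_two_neg_one_neg_one` (`(−1,−1)₂ = −1`: `ε(−1) = 1`, `χ₄(−1) = −1`), `localSign_neg_one_neg_one_of_ne_two`
  (`(−1,−1)_p = 1` for odd `p`: both entries are `p`-adic units), `localSign_neg_one_neg_one_eq_one_iff`.
* §2 **`isSplitAt_iff_not_dvd_two`**: `ℍ[ℚ]` is split at the finite place `v` iff `p_v ∤ 2` (the tree's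
  `isSplitAt_iff_hilbertSymbol_eq_one` + Serre's explicit signs `hilbertSymbol_rat_eq_localSign`); hence
  **`ramifiedPlaces_eq`**: `Ram_f ℍ[ℚ] = {v | p_v ∣ 2}` — the clause `ramifiedPlaces_eq` (with `N⁻ = 2`) of
  `Brandt.XiSetup`; `mem_ramifiedPlaces_iff_two_mem` (the `EichlerPackage` format `(2) ⊆ v`), `not_isSplitAt_of_dvd_two`.
* §3 **`isTotallyDefinite`**: `ℍ[ℚ]` is ramified at the (real) infinite place — `X² + Y² = −1` has no solution in
  `ℚ_∞ = ℝ` (`isSplitAtInfinite_quaternionAlgebra_iff` and the embedding `Completion.extensionEmbeddingOfIsReal`).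

## Sources

* M.-F. Vignéras, *Arithmétique des algèbres de quaternions*, LNM 800 (1980), Ch. II §1 Thm. 1.1 («Ram(H) = {v, H_v est
  un corps}»), Ch. III §1 Exemple («`Ram{a,b} = {v, (a,b)_v = −1}`»), Ch. III §3 (définie = ramifiée aux places
  infinies), Ch. III §5 Exercice 5.2 («le corps de quaternions sur `ℚ` de discriminant réduit … `p = 2,
  {a,b} = {−1,−1}`»). [cite: VignerasLNM800, Ch. II §1 Thm. 1.1; Ch. III §1 Exemple; Ch. III §5 Exercice 5.2]
* J.-P. Serre, *A Course in Arithmetic* (1973), Ch. III §1.2 Thm. 1 (the explicit Hilbert symbols over `ℚ_p` and `ℝ`: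
  `(−1,−1)_∞ = (−1,−1)₂ = −1`, `(−1,−1)_p = 1` for `p` odd). [cite: Serre1973, Ch. III §1.2 Thm. 1]
* J. Voight, *Quaternion Algebras*, GTM 288 (2021), 14.1 (Hamilton's quaternions over `ℚ` have discriminant `2`).
  [cite: Voight2021, Ex. 14.2.13 and 23.4.19]

## Scope (honest)

Theorems only — no definition, no named fact, no instance. Everything is the tree's general theory specialised to
`D = ℍ[ℚ]`; the Brandt setup itself (a structure VALUE, not a definition of the tree) is assembled in the sequel.
-/

open Quaternion
open scoped Pointwise
open IsDedekindDomain NumberField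
open Literature.NumberTheory.Waring
open Literature.NumberTheory.Automorphic.Brandt
open Literature.NumberTheory.QuadraticForms

namespace Literature.NumberTheory.Automorphic.HurwitzOrder

/-! ## §1 The Hilbert symbols `(−1,−1)_p` -/

section Signs

/-- **`(−1,−1)₂ = −1`** (`χ₄(−1) = −1`: `(−1)^{ε(−1)ε(−1)} = −1`). [cite: Serre1973, Ch. III §1.2 Thm. 1] -/
theorem localSign_two_neg_one_neg_one : localSign 2 (-1) (-1) = -1 := by
  rw [localSign, if_pos rfl, localSignTwo_of_odd (by norm_num) (by norm_num), epsSign_neg_one_left]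
  have : ZMod.χ₄ ((-1 : ℤ) : ZMod 4) = -1 := by decide
  rw [if_pos this]

/-- **`(−1,−1)_p = 1` for `p ≠ 2`** (both entries are `p`-adic units, `p` odd). [cite: Serre1973, Ch. III §1.2 Thm. 1] -/
theorem localSign_neg_one_neg_one_of_not_dvd {p : ℕ} (hp : p.Prime) (hp2 : ¬ p ∣ 2) :
    localSign p (-1) (-1) = 1 := by
  refine localSign_eq_one_of_not_dvd hp fun h => hp2 ?_
  have h' : (p : ℤ) ∣ 2 := by
    have e : (2 : ℤ) * -1 * -1 = 2 := by norm_num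
    rwa [e] at h
  exact_mod_cast h'

/-- `(−1,−1)_p = 1 ⟺ p ∤ 2` (`p` prime). [cite: Serre1973, Ch. III §1.2 Thm. 1] [cite: VignerasLNM800, Ch. III §1 Exemple] -/
theorem localSign_neg_one_neg_one_eq_one_iff {p : ℕ} (hp : p.Prime) : localSign p (-1) (-1) = 1 ↔ ¬ p ∣ 2 := by
  refine ⟨fun h hp2 => ?_, localSign_neg_one_neg_one_of_not_dvd hp⟩
  have := (Nat.prime_dvd_prime_iff_eq hp Nat.prime_two).1 hp2
  subst this
  rw [localSign_two_neg_one_neg_one] at h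
  norm_num at h

end Signs

/-! ## §2 `Ram_f ℍ[ℚ] = {2}` -/

section Ramification

/-- **`ℍ[ℚ] = (−1,−1)_ℚ` is split at the finite place `v` iff `p_v ∤ 2`** (`B_v ≅ M₂(ℚ_v) ⟺ (−1,−1)_v = 1`).
[cite: VignerasLNM800, Ch. II §1 Thm. 1.1 and Ch. III §1 Exemple («`Ram{a,b} = {v, (a,b)_v = −1}`»)] [cite: Serre1973, Ch. III §1.2 Thm. 1] -/
theorem isSplitAt_iff_not_dvd_two (v : HeightOneSpectrum (𝓞 ℚ)) :
    IsSplitAt ℍ[ℚ] v ↔ ¬ Rat.HeightOneSpectrum.natGenerator v ∣ 2 := by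
  have h := isSplitAt_iff_hilbertSymbol_eq_one ℚ ℍ[ℚ] (a := (-1 : ℚ)) (b := (-1 : ℚ)) (by norm_num) (by norm_num)
    AlgEquiv.refl v
  have hs := hilbertSymbol_rat_eq_localSign v (a := -1) (b := -1) (by norm_num) (by norm_num)
  push_cast at hs
  refine h.trans ?_
  rw [map_neg, map_one, hs, ← localSign_neg_one_neg_one_eq_one_iff (Rat.HeightOneSpectrum.prime_natGenerator v)]

/-- **`Ram_f ℍ[ℚ] = {v | p_v ∣ 2}`** — the ramification clause (discriminant `N⁻ = D(B) = 2`) of the Brandt setups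
`Brandt.XiSetup · 2`. [cite: VignerasLNM800, Ch. III §1 Exemple; Ch. III §5 Exercice 5.2] [cite: Voight2021, 23.4.19] -/
theorem ramifiedPlaces_eq :
    ramifiedPlaces ℚ ℍ[ℚ] = {v | ((Rat.HeightOneSpectrum.primesEquiv v : Nat.Primes) : ℕ) ∣ 2} := by
  ext v
  rw [mem_ramifiedPlaces_iff, isSplitAt_iff_not_dvd_two, not_not]
  rfl

/-- **`v ∈ Ram(B) ⟺ (2) ⊆ v`** — the ramification hypothesis in the `EichlerPackage` format.
[cite: VignerasLNM800, Ch. III §1 Exemple] -/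
theorem mem_ramifiedPlaces_iff_two_mem (v : HeightOneSpectrum (𝓞 ℚ)) :
    v ∈ ramifiedPlaces ℚ ℍ[ℚ] ↔ ((2 : ℕ) : 𝓞 ℚ) ∈ v.asIdeal := by
  rw [ramifiedPlaces_eq, Set.mem_setOf_eq, primesEquiv_dvd_iff]

/-- `ℍ[ℚ]` is NOT split at the place over `2`. [cite: VignerasLNM800, Ch. III §5 Exercice 5.2] -/
theorem not_isSplitAt_of_dvd_two {v : HeightOneSpectrum (𝓞 ℚ)} (hv : Rat.HeightOneSpectrum.natGenerator v ∣ 2) :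
    ¬ IsSplitAt ℍ[ℚ] v := by
  rw [isSplitAt_iff_not_dvd_two, not_not]
  exact hv

/-- `ℍ[ℚ]` IS split at every place over an odd prime. [cite: VignerasLNM800, Ch. III §1 Exemple] -/
theorem isSplitAt_of_not_dvd_two {v : HeightOneSpectrum (𝓞 ℚ)} (hv : ¬ Rat.HeightOneSpectrum.natGenerator v ∣ 2) :
    IsSplitAt ℍ[ℚ] v :=
  (isSplitAt_iff_not_dvd_two v).2 hv

end Ramification

/-! ## §3 `ℍ[ℚ]` is totally definite -/

section Definite

/-- **`ℍ[ℚ]` is totally definite**: it is ramified at the real place of `ℚ` — were `ℝ ⊗ ℍ[ℚ] ≅ M₂(ℝ)`, the equation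
`X² + Y² = −1` would be solvable in `ℚ_∞ = ℝ`. [cite: VignerasLNM800, Ch. III §3 (algèbre totalement définie) and Ch. III §5 Exercice 5.2] [cite: Serre1973, Ch. III §1.2 Thm. 1 (`(−1,−1)_∞ = −1`)] -/
theorem isTotallyDefinite : IsTotallyDefinite ℚ ℍ[ℚ] := by
  intro w hw
  have hwr : w.IsReal := IsTotallyReal.isReal w
  obtain ⟨x, y, hxy⟩ := (isSplitAtInfinite_quaternionAlgebra_iff (K := ℚ) (a := (-1 : ℚ)) (b := (-1 : ℚ))
    (by norm_num) (by norm_num) w).1 hw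
  rw [map_neg, map_one] at hxy
  have h2 := congr_arg (InfinitePlace.Completion.extensionEmbeddingOfIsReal hwr) hxy
  simp only [map_sub, map_mul, map_pow, map_neg, map_one] at h2
  nlinarith [sq_nonneg (InfinitePlace.Completion.extensionEmbeddingOfIsReal hwr x),
    sq_nonneg (InfinitePlace.Completion.extensionEmbeddingOfIsReal hwr y)]

end Definite

end Literature.NumberTheory.Automorphic.HurwitzOrder
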